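import Summits.Parity.GeneralizedHardyLittlewood.Theorems.BeyondDiagonalBeatsQuarter.KernelFormXSqTools
import Literature.NumberTheory.Sieve.GreenTao2008MoebiusLogSum
import Mathlib.NumberTheory.AbelSummation
import HarnessLib

/-!
# Route `PrimeLevelFamEdge`, crux K_A `MomentsBeyondDiagonal` (stmt-Parity-20007), line «petersson_layers» v4, stub `stub_diag`:
# **the Möbius log-power sums `Σ_{d ≤ x} μ(d) logᵃd / d = c_a + O(exp(−c√log x))`, every `a`** (brick D1 of «D4TAIL»)

The ONE analytic input still missing for the order-`(4,4)` remainder estimate (R₄₄) of `stub_diag` — hence for RUNG 4 — is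
«D4TAIL» (`…DiagRemBothSidedDecorFour`, hypothesis `hD4`): convergence with a power-of-log rate of the `D₄`-decorated Selberg
coefficients `Σ_{k ≤ y} a_n(k)D₄(k)`, `D₄ = 3P₂² − 2P₄`. Route (this lineage, g17): `D₄(k) = 𝔼[(Σ_{p∣k} ε_p log p)⁴]`
(Rademacher signs), and `τ(k)·𝔼[(Σ ε_p log p)^r] = Σ_{de = k}(log d − log e)^r`; attaching `log d` to `μ(d)/d` and `log e` to
`μ(e)/e` (the `t`-deformation `ζ(1+s−t)⁻¹ζ(1+s+t)⁻¹` of `ζ(1+s)⁻²`, analytic at `s = 0` for every `t`) expresses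
`Σ_{k ≤ y} a_n(k)D₄(k)` through the hyperbola sums `U_{ab}(z) = Σ_{de ≤ z} μ(d)μ(e) logᵃd logᵇe/(de)`, EACH of which converges
(to `c_a c_b`), instead of the individually divergent `Σ μ(d)P₄(d)/d`, `Σ μ(d)P₂(d)²/d`. This file is the one-variable input:

* `log_pow_mul_exp_neg_mul_sqrt_log_le` — `logⁿx · e^{−a√log x} ≤ (2n)!/a^{2n}` (`x ≥ 1`);
* `exists_abs_moebiusHarmonic_le_of_one_le` — the tree's `|m(t)| ≤ C e^{−c√log t}` (`m(t) = Σ_{k ≤ t} μ(k)/k`) patched to all `t ≥ 1`;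
* `sum_moebius_div_mul_log_pow_eq` — Abel summation `Σ_{k ≤ u} μ(k)logᵃk/k = m(u)logᵃu − a∫₁ᵘ m(t)log^{a−1}t dt/t` (`a ≥ 1`);
* `integrableOn_log_pow_mul_moebiusHarmonic_div`, `integral_Ioi_abs_log_pow_mul_moebiusHarmonic_div_le` — `∫₁^∞ logʲt·m(t)dt/t`
  converges absolutely, tail `≤ C e^{−(c/4)√log y}`;
* `exists_abs_sum_moebius_div_mul_log_pow_sub_le` — **`∀ a, ∃ c_a, c > 0, C: |Σ_{k ≤ x} μ(k)logᵃk/k − c_a| ≤ C e^{−c√log x}`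
  for all `x ≥ 1`** (`c_a = −a∫₁^∞ m(t)log^{a−1}t dt/t`; `c₀ = 0`, `c₁ = −1`, `c₂ = −2γ`, … — the Taylor data of `1/ζ(1+s)`);
* `exists_abs_sum_moebius_div_mul_log_pow_sub_le_pow` — the same in the `(1 + log x)⁻ᵏ` currency of the consumers (every `k`,
  one `c_a`), and `exists_abs_sum_moebius_div_mul_log_pow_le` — the uniform bound.

Def-free; theorems only; classical (Landau / de la Vallée-Poussin rate; the tree has `a = 0`
`…GreenTao2008.exists_abs_moebiusHarmonic_le`, `a = 1` `…abs_sum_moebius_mul_log_div_add_one_le` and the Riesz mean `R₂`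
`…DiagRemP2RieszTwo`). Helper `--supports stmt-Parity-20007`; closes nothing; K_A, K_B and the Parity summit are NOT proved;
nothing about Landau–Siegel zeros.

## References
* H. L. Montgomery, R. C. Vaughan, *Multiplicative Number Theory I*, CUP 2007, Thm. 6.9 and §8.1 (8.6)–(8.8).
  [cite: MontgomeryVaughan2007, §8.1 — derivation (log-power weights, same partial summation)]
* E. Kowalski, P. Michel, J. VanderKam, J. reine angew. Math. 526 (2000), Prop. 5.1 p. 18 (where these sums are consumed).
  [cite: KowalskiMichelVanderKam2000, Prop. 5.1 — derivation]
-/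

noncomputable section

open Real MeasureTheory Set Finset
open scoped ArithmeticFunction.Moebius

namespace Summit.Parity.GeneralizedHardyLittlewood.Theorems.MomentsBeyondDiagonal.DiagCorner

open Literature.NumberTheory.Sieve.GreenTao2008
open Literature.NumberTheory.LFunctions (MoebiusSum.integrableOn_exp_neg_mul_sqrt_log_div)
open Summit.Parity.GeneralizedHardyLittlewood.Theorems.BeyondDiagonalBeatsQuarter.KernelFormXSq (exp_neg_sqrt_le_div_pow)

/-! ### Two elementary tools -/

/-- `logⁿx · e^{−a√log x} ≤ (2n)!/a^{2n}` for `a > 0`, `x ≥ 1` (from `yᵐ/m! ≤ eʸ` at `y = a√log x`, `m = 2n`). [folklore] -/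
theorem log_pow_mul_exp_neg_mul_sqrt_log_le {a : ℝ} (ha : 0 < a) (n : ℕ) {x : ℝ} (hx : 1 ≤ x) :
    Real.log x ^ n * Real.exp (-(a * Real.sqrt (Real.log x))) ≤ ((2 * n).factorial : ℝ) / a ^ (2 * n) := by
  set u : ℝ := Real.sqrt (Real.log x) with hu
  have hL0 : 0 ≤ Real.log x := Real.log_nonneg hx
  have hu0 : 0 ≤ u := Real.sqrt_nonneg _
  have huL : u ^ 2 = Real.log x := Real.sq_sqrt hL0
  have hfac : (0 : ℝ) < (2 * n).factorial := by exact_mod_cast (2 * n).factorial_pos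
  have han : 0 < a ^ (2 * n) := pow_pos ha _
  have hf := Real.pow_div_factorial_le_exp (a * u) (by positivity) (2 * n)
  rw [div_le_iff₀ hfac, mul_pow] at hf
  -- `hf : a^{2n} u^{2n} ≤ e^{au} (2n)!`
  rw [← huL, ← pow_mul, le_div_iff₀ han, Real.exp_neg]
  have hexp : 0 < Real.exp (a * u) := Real.exp_pos _
  have key : u ^ (2 * n) * a ^ (2 * n) ≤ ((2 * n).factorial : ℝ) * Real.exp (a * u) := by
    rw [mul_comm]; exact hf.trans (le_of_eq (mul_comm _ _))
  calc u ^ (2 * n) * (Real.exp (a * u))⁻¹ * a ^ (2 * n)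
      = u ^ (2 * n) * a ^ (2 * n) / Real.exp (a * u) := by rw [div_eq_mul_inv]; ring
    _ ≤ ((2 * n).factorial : ℝ) * Real.exp (a * u) / Real.exp (a * u) :=
        div_le_div_of_nonneg_right key hexp.le
    _ = ((2 * n).factorial : ℝ) := by field_simp

/-- The tree's de la Vallée-Poussin bound `|m(t)| ≤ C₀e^{−c₀√log t}` (`t ≥ 2`), patched to **all `t ≥ 1`** (on `[1,2]`,
`|m(t)| ≤ t ≤ 2 ≤ 2e^{c₀}e^{−c₀√log t}`). [cite: MontgomeryVaughan2007, Theorem 6.9 (6.12) — derivation] -/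
theorem exists_abs_moebiusHarmonic_le_of_one_le :
    ∃ c₀ : ℝ, 0 < c₀ ∧ ∃ C₁ : ℝ, 0 ≤ C₁ ∧ ∀ t : ℝ, 1 ≤ t →
      |moebiusHarmonic t| ≤ C₁ * Real.exp (-(c₀ * Real.sqrt (Real.log t))) := by
  obtain ⟨c₀, hc₀, C₀, hC₀, hmb⟩ := exists_abs_moebiusHarmonic_le
  refine ⟨c₀, hc₀, C₀ + 2 * Real.exp c₀, by positivity, fun t ht ↦ ?_⟩
  have hE : 0 < Real.exp (-(c₀ * Real.sqrt (Real.log t))) := Real.exp_pos _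
  rcases le_or_gt 2 t with h2 | h2
  · calc |moebiusHarmonic t| ≤ C₀ * Real.exp (-(c₀ * Real.sqrt (Real.log t))) := hmb t h2
      _ ≤ (C₀ + 2 * Real.exp c₀) * Real.exp (-(c₀ * Real.sqrt (Real.log t))) := by
          gcongr; linarith [Real.exp_pos c₀]
  · -- `1 ≤ t < 2`
    have ht0 : 0 ≤ t := by linarith
    have hm : |moebiusHarmonic t| ≤ 2 := (abs_moebiusHarmonic_le ht0).trans h2.le
    have hlog : Real.log t ≤ 1 := by
      have h1 : Real.log t ≤ Real.log 2 := Real.log_le_log (by linarith) h2.le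
      have := Real.log_two_lt_d9; linarith
    have hsq : Real.sqrt (Real.log t) ≤ 1 := by
      rw [show (1 : ℝ) = Real.sqrt 1 by simp]; exact Real.sqrt_le_sqrt hlog
    have hexp : 1 ≤ Real.exp c₀ * Real.exp (-(c₀ * Real.sqrt (Real.log t))) := by
      rw [← Real.exp_add]; exact Real.one_le_exp (by nlinarith)
    calc |moebiusHarmonic t| ≤ 2 := hm
      _ ≤ 2 * (Real.exp c₀ * Real.exp (-(c₀ * Real.sqrt (Real.log t)))) := by linarith
      _ ≤ (C₀ + 2 * Real.exp c₀) * Real.exp (-(c₀ * Real.sqrt (Real.log t))) := by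
          nlinarith [mul_nonneg hC₀ hE.le]

/-! ### Abel summation: `Σ_{k ≤ u} μ(k)logᵃk/k = m(u)logᵃu − a∫₁ᵘ m(t)log^{a−1}t dt/t` -/

/-- **Abel summation for the log-power weight**: for `u ≥ 1` and `a ≥ 1`,
`Σ_{k ≤ u} μ(k)logᵃk/k = m(u)·logᵃu − ∫₁ᵘ (a log^{a−1}t / t)·m(t) dt`. [cite: MontgomeryVaughan2007, §8.1 — derivation] -/
theorem sum_moebius_div_mul_log_pow_eq {u : ℝ} (hu : 1 ≤ u) {a : ℕ} (ha : a ≠ 0) :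
    ∑ k ∈ Icc 1 ⌊u⌋₊, (μ k : ℝ) / k * Real.log k ^ a =
      moebiusHarmonic u * Real.log u ^ a -
        ∫ t in Set.Ioc 1 u, (a * Real.log t ^ (a - 1) * t⁻¹) * moebiusHarmonic t := by
  have hu0 : 0 < u := by linarith
  set f : ℝ → ℝ := fun t ↦ Real.log t ^ a with hf
  have hfpi : f = Real.log ^ a := by ext t; simp [hf]
  have hfd : ∀ t : ℝ, 0 < t → HasDerivAt f (a * Real.log t ^ (a - 1) * t⁻¹) t := fun t ht ↦ by
    rw [hfpi]; exact (Real.hasDerivAt_log ht.ne').pow a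
  have hf_diff : ∀ t ∈ Set.Icc (1 : ℝ) u, DifferentiableAt ℝ f t := fun t ht ↦
    (hfd t (by linarith [ht.1])).differentiableAt
  have hderiv : ∀ t : ℝ, 0 < t → deriv f t = a * Real.log t ^ (a - 1) * t⁻¹ := fun t ht ↦ (hfd t ht).deriv
  have hcont : ContinuousOn (fun t : ℝ ↦ (a : ℝ) * Real.log t ^ (a - 1) * t⁻¹) (Set.Icc 1 u) := by
    refine ContinuousOn.mul (ContinuousOn.mul continuousOn_const
      ((Real.continuousOn_log.mono ?_).pow _)) (ContinuousOn.inv₀ continuousOn_id ?_)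
    · intro t ht; simp only [Set.mem_compl_iff, Set.mem_singleton_iff]; exact (by linarith [ht.1] : t ≠ 0)
    · intro t ht; exact (by linarith [ht.1] : t ≠ 0)
  have hf_int : IntegrableOn (deriv f) (Set.Icc (1 : ℝ) u) := by
    refine (hcont.integrableOn_Icc).congr_fun (fun t ht ↦ ?_) measurableSet_Icc
    exact (hderiv t (by linarith [ht.1])).symm
  have h := sum_mul_eq_sub_sub_integral_mul (fun k ↦ (μ k : ℝ) / k) zero_le_one hu hf_diff hf_int
  rw [Nat.floor_one] at h
  have h01 : ∑ k ∈ Finset.Icc 0 1, (μ k : ℝ) / k = 1 := by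
    rw [show Finset.Icc 0 1 = {0, 1} from rfl, Finset.sum_pair (by norm_num)]
    simp
  have hf1 : f 1 = 0 := by simp [hf, ha]
  rw [h01, hf1, zero_mul, sub_zero] at h
  -- the partial sums `∑_{0 ≤ k ≤ ⌊t⌋} μ(k)/k` are `m(t)`
  have hS : ∀ t : ℝ, ∑ k ∈ Finset.Icc 0 ⌊t⌋₊, (μ k : ℝ) / k = moebiusHarmonic t := by
    intro t
    rw [moebiusHarmonic, Finset.Icc_eq_cons_Ioc (Nat.zero_le _), Finset.sum_cons]
    simp only [ArithmeticFunction.map_zero, Int.cast_zero, Nat.cast_zero, div_zero, zero_add]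
    rfl
  simp_rw [hS] at h
  have hint : ∫ t in Set.Ioc 1 u, deriv f t * moebiusHarmonic t =
      ∫ t in Set.Ioc 1 u, (a * Real.log t ^ (a - 1) * t⁻¹) * moebiusHarmonic t := by
    refine setIntegral_congr_fun measurableSet_Ioc fun t ht ↦ ?_
    rw [hderiv t (by linarith [ht.1])]
  rw [hint] at h
  -- `Σ_{k ≤ u} = (k = 1 term, = 0) + Σ_{1 < k ≤ u} f(k) c(k)`
  have hsplit : ∑ k ∈ Icc 1 ⌊u⌋₊, (μ k : ℝ) / k * Real.log k ^ a =
      ∑ k ∈ Finset.Ioc 1 ⌊u⌋₊, f k * ((μ k : ℝ) / k) := by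
    rw [Finset.Icc_eq_cons_Ioc (Nat.one_le_iff_ne_zero.mpr (Nat.floor_pos.mpr hu).ne'), Finset.sum_cons]
    simp only [Nat.cast_one, Real.log_one, zero_pow ha, mul_zero, zero_add]
    exact Finset.sum_congr rfl fun k _ ↦ by rw [hf]; ring
  rw [hsplit, h]
  simp only [hf]
  ring

/-! ### The integrals `∫₁^∞ logʲt · m(t) dt/t` -/

section FromBound

variable {c₀ C₁ : ℝ}

/-- Pointwise: under `|m(t)| ≤ C₁e^{−c₀√log t}` (`t ≥ 1`), for `t ≥ 1`,
`|logʲt · m(t)/t| ≤ ((2j)!/(c₀/2)^{2j})·C₁ · e^{−(c₀/2)√log t}/t`. [folklore] -/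
theorem abs_log_pow_mul_moebiusHarmonic_div_le (hc₀ : 0 < c₀) (hC₁ : 0 ≤ C₁)
    (hmb : ∀ t : ℝ, 1 ≤ t → |moebiusHarmonic t| ≤ C₁ * Real.exp (-(c₀ * Real.sqrt (Real.log t))))
    (j : ℕ) {t : ℝ} (ht : 1 ≤ t) :
    |Real.log t ^ j * moebiusHarmonic t / t| ≤
      ((2 * j).factorial : ℝ) / (c₀ / 2) ^ (2 * j) * C₁ * (Real.exp (-(c₀ / 2 * Real.sqrt (Real.log t))) / t) := by
  have ht0 : 0 < t := by linarith
  have hL0 : 0 ≤ Real.log t := Real.log_nonneg ht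
  set K : ℝ := ((2 * j).factorial : ℝ) / (c₀ / 2) ^ (2 * j) with hK
  have hK0 : 0 ≤ K := by positivity
  have hsplit : Real.exp (-(c₀ * Real.sqrt (Real.log t))) =
      Real.exp (-(c₀ / 2 * Real.sqrt (Real.log t))) * Real.exp (-(c₀ / 2 * Real.sqrt (Real.log t))) := by
    rw [← Real.exp_add]; ring_nf
  have hlogK : Real.log t ^ j * Real.exp (-(c₀ / 2 * Real.sqrt (Real.log t))) ≤ K :=
    log_pow_mul_exp_neg_mul_sqrt_log_le (half_pos hc₀) j ht
  rw [abs_div, abs_of_pos ht0, abs_mul, abs_of_nonneg (pow_nonneg hL0 j)]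
  have hm := hmb t ht
  have hE2 : 0 ≤ Real.exp (-(c₀ / 2 * Real.sqrt (Real.log t))) := (Real.exp_pos _).le
  calc Real.log t ^ j * |moebiusHarmonic t| / t
      ≤ Real.log t ^ j * (C₁ * Real.exp (-(c₀ * Real.sqrt (Real.log t)))) / t := by
        gcongr
    _ = (Real.log t ^ j * Real.exp (-(c₀ / 2 * Real.sqrt (Real.log t)))) * C₁ *
          (Real.exp (-(c₀ / 2 * Real.sqrt (Real.log t))) / t) := by rw [hsplit]; ring
    _ ≤ K * C₁ * (Real.exp (-(c₀ / 2 * Real.sqrt (Real.log t))) / t) := by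
        gcongr

/-- **`logʲt · m(t)/t` is integrable on `(1, ∞)`** under `|m(t)| ≤ C₁e^{−c₀√log t}` (`t ≥ 1`). [folklore] -/
theorem integrableOn_log_pow_mul_moebiusHarmonic_div (hc₀ : 0 < c₀) (hC₁ : 0 ≤ C₁)
    (hmb : ∀ t : ℝ, 1 ≤ t → |moebiusHarmonic t| ≤ C₁ * Real.exp (-(c₀ * Real.sqrt (Real.log t)))) (j : ℕ) :
    IntegrableOn (fun t : ℝ ↦ Real.log t ^ j * moebiusHarmonic t / t) (Set.Ioi 1) volume := by
  have hmeas : Measurable fun t : ℝ ↦ Real.log t ^ j * moebiusHarmonic t / t :=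
    ((Real.measurable_log.pow_const j).mul measurable_moebiusHarmonic).div measurable_id
  refine Integrable.mono'
    ((MoebiusSum.integrableOn_exp_neg_mul_sqrt_log_div (half_pos hc₀)).const_mul
      (((2 * j).factorial : ℝ) / (c₀ / 2) ^ (2 * j) * C₁))
    hmeas.aestronglyMeasurable ?_
  refine ae_restrict_of_forall_mem measurableSet_Ioi fun t ht ↦ ?_
  rw [Real.norm_eq_abs]
  exact abs_log_pow_mul_moebiusHarmonic_div_le hc₀ hC₁ hmb j (le_of_lt ht)

/-- **The tail**: under `|m(t)| ≤ C₁e^{−c₀√log t}` (`t ≥ 1`), for `y ≥ 1`,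
`∫_{(y,∞)} |logʲt · m(t)/t| dt ≤ ((2j)!/(c₀/2)^{2j})·C₁·K₄·e^{−(c₀/4)√log y}`, `K₄ = ∫₁^∞ e^{−(c₀/4)√log t}dt/t`. [folklore] -/
theorem integral_Ioi_abs_log_pow_mul_moebiusHarmonic_div_le (hc₀ : 0 < c₀) (hC₁ : 0 ≤ C₁)
    (hmb : ∀ t : ℝ, 1 ≤ t → |moebiusHarmonic t| ≤ C₁ * Real.exp (-(c₀ * Real.sqrt (Real.log t)))) (j : ℕ)
    {y : ℝ} (hy : 1 ≤ y) :
    ∫ t in Set.Ioi y, |Real.log t ^ j * moebiusHarmonic t / t| ≤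
      ((2 * j).factorial : ℝ) / (c₀ / 2) ^ (2 * j) * C₁ *
        (∫ t in Set.Ioi 1, Real.exp (-(c₀ / 4 * Real.sqrt (Real.log t))) / t) *
          Real.exp (-(c₀ / 4 * Real.sqrt (Real.log y))) := by
  set K : ℝ := ((2 * j).factorial : ℝ) / (c₀ / 2) ^ (2 * j) * C₁ with hK
  have hK0 : 0 ≤ K := by positivity
  set K₄ := ∫ t in Set.Ioi 1, Real.exp (-(c₀ / 4 * Real.sqrt (Real.log t))) / t with hK₄
  set Ey := Real.exp (-(c₀ / 4 * Real.sqrt (Real.log y))) with hEy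
  have hsub : Set.Ioi y ⊆ Set.Ioi 1 := Set.Ioi_subset_Ioi hy
  have hint : IntegrableOn (fun t : ℝ ↦ Real.log t ^ j * moebiusHarmonic t / t) (Set.Ioi y) :=
    (integrableOn_log_pow_mul_moebiusHarmonic_div hc₀ hC₁ hmb j).mono_set hsub
  have hdom : IntegrableOn (fun t : ℝ ↦ Real.exp (-(c₀ / 4 * Real.sqrt (Real.log t))) / t) (Set.Ioi 1) :=
    MoebiusSum.integrableOn_exp_neg_mul_sqrt_log_div (by positivity : 0 < c₀ / 4)
  have hpt : ∀ t ∈ Set.Ioi y, |Real.log t ^ j * moebiusHarmonic t / t| ≤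
      K * Ey * (Real.exp (-(c₀ / 4 * Real.sqrt (Real.log t))) / t) := by
    intro t ht
    have ht1 : 1 ≤ t := hy.trans (le_of_lt ht)
    have ht0 : 0 < t := by linarith
    have h := abs_log_pow_mul_moebiusHarmonic_div_le hc₀ hC₁ hmb j ht1
    have hexp : Real.exp (-(c₀ / 2 * Real.sqrt (Real.log t))) ≤
        Ey * Real.exp (-(c₀ / 4 * Real.sqrt (Real.log t))) := by
      rw [hEy, ← Real.exp_add]
      have hsqrt : Real.sqrt (Real.log y) ≤ Real.sqrt (Real.log t) :=
        Real.sqrt_le_sqrt (Real.log_le_log (by linarith) ht.le)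
      exact Real.exp_le_exp.2 (by nlinarith [hc₀.le])
    calc |Real.log t ^ j * moebiusHarmonic t / t| ≤ K * (Real.exp (-(c₀ / 2 * Real.sqrt (Real.log t))) / t) := h
      _ ≤ K * ((Ey * Real.exp (-(c₀ / 4 * Real.sqrt (Real.log t)))) / t) := by gcongr
      _ = K * Ey * (Real.exp (-(c₀ / 4 * Real.sqrt (Real.log t))) / t) := by ring
  calc ∫ t in Set.Ioi y, |Real.log t ^ j * moebiusHarmonic t / t|
      ≤ ∫ t in Set.Ioi y, K * Ey * (Real.exp (-(c₀ / 4 * Real.sqrt (Real.log t))) / t) :=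
        setIntegral_mono_on hint.abs ((hdom.mono_set hsub).const_mul _) measurableSet_Ioi hpt
    _ = K * Ey * ∫ t in Set.Ioi y, Real.exp (-(c₀ / 4 * Real.sqrt (Real.log t))) / t := by
        rw [integral_const_mul]
    _ ≤ K * Ey * K₄ := by
        refine mul_le_mul_of_nonneg_left ?_ (by positivity)
        refine setIntegral_mono_set hdom ?_ hsub.eventuallyLE
        exact ae_restrict_of_forall_mem measurableSet_Ioi fun t ht ↦
          div_nonneg (Real.exp_pos _).le (zero_le_one.trans ht.le)
    _ = K * K₄ * Ey := by ring

end FromBound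

/-! ### The asymptotic with the de la Vallée-Poussin rate -/

/-- **`Σ_{k ≤ x} μ(k)logᵃk/k = c_a + O(e^{−c√log x})`**, every `a : ℕ`: there are `c_a`, `c > 0` and `C ≥ 0` with
`|Σ_{k ≤ x} μ(k)/k·logᵃk − c_a| ≤ C·exp(−c√log x)` for all real `x ≥ 1` (`c_a = −a∫₁^∞ m(t)log^{a−1}t dt/t`, `c₀ = 0`).
[cite: MontgomeryVaughan2007, §8.1 (8.6)–(8.8) — derivation (log-power weights)] -/
theorem exists_abs_sum_moebius_div_mul_log_pow_sub_le (a : ℕ) :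
    ∃ ca c : ℝ, 0 < c ∧ ∃ C : ℝ, 0 ≤ C ∧ ∀ x : ℝ, 1 ≤ x →
      |(∑ k ∈ Icc 1 ⌊x⌋₊, (ArithmeticFunction.moebius k : ℝ) / k * Real.log k ^ a) - ca| ≤
        C * Real.exp (-(c * Real.sqrt (Real.log x))) := by
  obtain ⟨c₀, hc₀, C₁, hC₁, hmb⟩ := exists_abs_moebiusHarmonic_le_of_one_le
  rcases Nat.eq_zero_or_pos a with rfl | ha
  · -- `a = 0`: the sum is `m(x)`, `c₀ = 0`
    refine ⟨0, c₀, hc₀, C₁, hC₁, fun x hx ↦ ?_⟩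
    have : ∑ k ∈ Icc 1 ⌊x⌋₊, (ArithmeticFunction.moebius k : ℝ) / k * Real.log k ^ 0 = moebiusHarmonic x := by
      rw [moebiusHarmonic_def]; exact Finset.sum_congr rfl fun k _ ↦ by rw [pow_zero, mul_one]
    rw [this, sub_zero]
    exact hmb x hx
  · -- `a ≥ 1`
    have ha0 : a ≠ 0 := by omega
    set K₄ := ∫ t in Set.Ioi 1, Real.exp (-(c₀ / 4 * Real.sqrt (Real.log t))) / t with hK₄
    have hK₄0 : 0 ≤ K₄ := setIntegral_nonneg measurableSet_Ioi fun t ht ↦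
      div_nonneg (Real.exp_pos _).le (zero_le_one.trans ht.le)
    set Ka : ℝ := ((2 * a).factorial : ℝ) / (c₀ / 2) ^ (2 * a) with hKa
    set Kt : ℝ := ((2 * (a - 1)).factorial : ℝ) / (c₀ / 2) ^ (2 * (a - 1)) * C₁ with hKt
    have hKa0 : 0 ≤ Ka := by positivity
    have hKt0 : 0 ≤ Kt := by positivity
    set g : ℝ → ℝ := fun t ↦ Real.log t ^ (a - 1) * moebiusHarmonic t / t with hg
    have hgint : IntegrableOn g (Set.Ioi 1) := integrableOn_log_pow_mul_moebiusHarmonic_div hc₀ hC₁ hmb (a - 1)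
    refine ⟨-(a * ∫ t in Set.Ioi 1, g t), c₀ / 4, by positivity, Ka * C₁ + a * (Kt * K₄), by positivity,
      fun x hx ↦ ?_⟩
    have hx0 : 0 < x := by linarith
    have hL0 : 0 ≤ Real.log x := Real.log_nonneg hx
    -- Abel summation and the identification of the integrand
    have hAbel := sum_moebius_div_mul_log_pow_eq hx ha0
    have hI : ∫ t in Set.Ioc 1 x, (a * Real.log t ^ (a - 1) * t⁻¹) * moebiusHarmonic t =
        a * ∫ t in Set.Ioc 1 x, g t := by
      rw [← integral_const_mul]
      refine setIntegral_congr_fun measurableSet_Ioc fun t _ ↦ ?_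
      rw [hg]; dsimp only; rw [div_eq_mul_inv]; ring
    -- `∫_{(1,x]} g = ∫_{(1,∞)} g − ∫_{(x,∞)} g`
    have hsplit : ∫ t in Set.Ioc 1 x, g t = (∫ t in Set.Ioi 1, g t) - ∫ t in Set.Ioi x, g t := by
      have hunion : Set.Ioc 1 x ∪ Set.Ioi x = Set.Ioi 1 := Set.Ioc_union_Ioi_eq_Ioi hx
      have hdisj : Disjoint (Set.Ioc 1 x) (Set.Ioi x) := fun s hs1 hs2 t ht ↦
        absurd (lt_of_lt_of_le (Set.mem_Ioi.mp (hs2 ht)) (Set.mem_Ioc.mp (hs1 ht)).2) (lt_irrefl _)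
      have h := setIntegral_union hdisj measurableSet_Ioi (hgint.mono_set Set.Ioc_subset_Ioi_self)
        (hgint.mono_set (Set.Ioi_subset_Ioi hx))
      rw [hunion] at h
      linarith
    have hsum : ∑ k ∈ Icc 1 ⌊x⌋₊, (ArithmeticFunction.moebius k : ℝ) / k * Real.log k ^ a =
        moebiusHarmonic x * Real.log x ^ a - a * ((∫ t in Set.Ioi 1, g t) - ∫ t in Set.Ioi x, g t) := by
      rw [hAbel, hI, hsplit]
    rw [hsum]
    have hrew : moebiusHarmonic x * Real.log x ^ a - a * ((∫ t in Set.Ioi 1, g t) - ∫ t in Set.Ioi x, g t) -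
        -(a * ∫ t in Set.Ioi 1, g t) = moebiusHarmonic x * Real.log x ^ a + a * ∫ t in Set.Ioi x, g t := by ring
    rw [hrew]
    -- the two terms
    have hE24 : Real.exp (-(c₀ / 2 * Real.sqrt (Real.log x))) ≤ Real.exp (-(c₀ / 4 * Real.sqrt (Real.log x))) :=
      Real.exp_le_exp.2 (by nlinarith [Real.sqrt_nonneg (Real.log x), hc₀.le])
    have h1 : |moebiusHarmonic x * Real.log x ^ a| ≤ Ka * C₁ * Real.exp (-(c₀ / 4 * Real.sqrt (Real.log x))) := by
      have hsplit2 : Real.exp (-(c₀ * Real.sqrt (Real.log x))) =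
          Real.exp (-(c₀ / 2 * Real.sqrt (Real.log x))) * Real.exp (-(c₀ / 2 * Real.sqrt (Real.log x))) := by
        rw [← Real.exp_add]; ring_nf
      have hlogK : Real.log x ^ a * Real.exp (-(c₀ / 2 * Real.sqrt (Real.log x))) ≤ Ka :=
        log_pow_mul_exp_neg_mul_sqrt_log_le (half_pos hc₀) a hx
      have hE2 : 0 ≤ Real.exp (-(c₀ / 2 * Real.sqrt (Real.log x))) := (Real.exp_pos _).le
      rw [abs_mul, abs_of_nonneg (pow_nonneg hL0 a)]
      calc |moebiusHarmonic x| * Real.log x ^ a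
          ≤ C₁ * Real.exp (-(c₀ * Real.sqrt (Real.log x))) * Real.log x ^ a := by
            gcongr; exact hmb x hx
        _ = (Real.log x ^ a * Real.exp (-(c₀ / 2 * Real.sqrt (Real.log x)))) * C₁ *
              Real.exp (-(c₀ / 2 * Real.sqrt (Real.log x))) := by rw [hsplit2]; ring
        _ ≤ Ka * C₁ * Real.exp (-(c₀ / 2 * Real.sqrt (Real.log x))) := by gcongr
        _ ≤ Ka * C₁ * Real.exp (-(c₀ / 4 * Real.sqrt (Real.log x))) := by gcongr
    have h2 : |(a : ℝ) * ∫ t in Set.Ioi x, g t| ≤ a * (Kt * K₄) * Real.exp (-(c₀ / 4 * Real.sqrt (Real.log x))) := by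
      rw [abs_mul, Nat.abs_cast, mul_assoc, mul_assoc]
      refine mul_le_mul_of_nonneg_left ?_ (Nat.cast_nonneg a)
      calc |∫ t in Set.Ioi x, g t| ≤ ∫ t in Set.Ioi x, |g t| := abs_integral_le_integral_abs
        _ ≤ Kt * K₄ * Real.exp (-(c₀ / 4 * Real.sqrt (Real.log x))) :=
            integral_Ioi_abs_log_pow_mul_moebiusHarmonic_div_le hc₀ hC₁ hmb (a - 1) hx
        _ = Kt * (K₄ * Real.exp (-(c₀ / 4 * Real.sqrt (Real.log x)))) := by ring
    calc |moebiusHarmonic x * Real.log x ^ a + a * ∫ t in Set.Ioi x, g t|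
        ≤ |moebiusHarmonic x * Real.log x ^ a| + |(a : ℝ) * ∫ t in Set.Ioi x, g t| := abs_add_le _ _
      _ ≤ Ka * C₁ * Real.exp (-(c₀ / 4 * Real.sqrt (Real.log x))) +
            a * (Kt * K₄) * Real.exp (-(c₀ / 4 * Real.sqrt (Real.log x))) := add_le_add h1 h2
      _ = (Ka * C₁ + a * (Kt * K₄)) * Real.exp (-(c₀ / 4 * Real.sqrt (Real.log x))) := by ring

/-- **The same in the `(1 + log x)⁻ᵏ` currency, one constant `c_a` for every `k`**: for every `a` there is `c_a` such that for
every `k` there is `K ≥ 0` with `|Σ_{d ≤ x} μ(d)/d·logᵃd − c_a| ≤ K/(1 + log x)ᵏ` for all `x ≥ 1`.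
[cite: MontgomeryVaughan2007, §8.1 (8.6)–(8.8) — derivation (log-power weights)] -/
theorem exists_abs_sum_moebius_div_mul_log_pow_sub_le_pow (a : ℕ) :
    ∃ ca : ℝ, ∀ k : ℕ, ∃ K : ℝ, 0 ≤ K ∧ ∀ x : ℝ, 1 ≤ x →
      |(∑ d ∈ Icc 1 ⌊x⌋₊, (ArithmeticFunction.moebius d : ℝ) / d * Real.log d ^ a) - ca| ≤
        K / (1 + Real.log x) ^ k := by
  obtain ⟨ca, c, hc, C, hC, h⟩ := exists_abs_sum_moebius_div_mul_log_pow_sub_le a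
  refine ⟨ca, fun k ↦ ?_⟩
  obtain ⟨K₀, hK₀, hK⟩ := exp_neg_sqrt_le_div_pow hc k
  refine ⟨C * K₀, by positivity, fun x hx ↦ ?_⟩
  have hL0 : 0 ≤ Real.log x := Real.log_nonneg hx
  calc _ ≤ C * Real.exp (-(c * Real.sqrt (Real.log x))) := h x hx
    _ ≤ C * (K₀ / (1 + Real.log x) ^ k) := mul_le_mul_of_nonneg_left (hK _ hL0) hC
    _ = C * K₀ / (1 + Real.log x) ^ k := by ring

/-- **Uniform bound**: for every `a` there is `B ≥ 0` with `|Σ_{d ≤ x} μ(d)/d·logᵃd| ≤ B` for every real `x`. [folklore] -/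
theorem exists_abs_sum_moebius_div_mul_log_pow_le (a : ℕ) :
    ∃ B : ℝ, 0 ≤ B ∧ ∀ x : ℝ,
      |∑ d ∈ Icc 1 ⌊x⌋₊, (ArithmeticFunction.moebius d : ℝ) / d * Real.log d ^ a| ≤ B := by
  obtain ⟨ca, h⟩ := exists_abs_sum_moebius_div_mul_log_pow_sub_le_pow a
  obtain ⟨K, hK, hKx⟩ := h 0
  refine ⟨K + |ca|, by positivity, fun x ↦ ?_⟩
  rcases lt_or_ge x 1 with hx | hx
  · have : ⌊x⌋₊ = 0 := Nat.floor_eq_zero.mpr hx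
    rw [this, show Finset.Icc (1 : ℕ) 0 = ∅ from Finset.Icc_eq_empty (by norm_num), Finset.sum_empty, abs_zero]
    positivity
  · have h1 := hKx x hx
    rw [pow_zero, div_one] at h1
    have : |∑ d ∈ Icc 1 ⌊x⌋₊, (ArithmeticFunction.moebius d : ℝ) / d * Real.log d ^ a| ≤
        |(∑ d ∈ Icc 1 ⌊x⌋₊, (ArithmeticFunction.moebius d : ℝ) / d * Real.log d ^ a) - ca| + |ca| := by
      have := abs_add_le ((∑ d ∈ Icc 1 ⌊x⌋₊, (ArithmeticFunction.moebius d : ℝ) / d * Real.log d ^ a) - ca) ca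
      simpa using this
    linarith

end Summit.Parity.GeneralizedHardyLittlewood.Theorems.MomentsBeyondDiagonal.DiagCorner

end
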